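import Summits.AtomisticToContinuum.FouriersLaw.Theorems.PhononMeanFreePathCoherentDephasingStrictAbsorptionStatics
import Summits.AtomisticToContinuum.FouriersLaw.Theorems.PhononMeanFreePathCoherentDephasingWeakCouplingIntegrability

/-!
# Strict absorption — preparatory lemmas (line `Sketch`, crux `PhononMeanFreePath.CoherentDephasing`,
# stmt-AtomisticToContinuum-11810, lead c2)

Chain-free and fixed-`N` tools for the assembly of the `N`-uniform strict-absorption theorem:

* `sa_taylorThree` (registered sub-goal) / `prep_taylor3` — the third-order short-time envelope: if
  `A(r) = ∫₀ʳ B`, `B(s) = ∫₀ˢ C`, `C(u) = c₀ + ∫₀ᵘ D` with `|D| ≤ M` on `[0, ∞)` (all measurable and locally bounded), then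
  `|A(r) - c₀ r²/2| ≤ M r³/6` for `r ≥ 0`;
* `prep_uniform_even_moments` — `N`-uniform even moments of positions AND momenta under the Gibbs measure, with
  integrability (`gibbs_position_moment_le` + the momentum half of `stub_gibbsMoments`);
* `prep_abs_corr_le` — `|∫ a · (K_u g) dμ_T| ≤ (∫ a² + ∫ g²)/2` (`L²`-contraction of the kernels and AM–GM).

No definition, no `sorry`, standard axioms.
-/

noncomputable section

open MeasureTheory ProbabilityTheory Filter Topology Set intervalIntegral
open scoped NNReal ENNReal

namespace Summit.AtomisticToContinuum.FouriersLaw.Theorems.CoherentDephasing.StrictAbsorption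

open Literature.MathematicalPhysics.KineticTheory.HeatConduction
open Literature.MathematicalPhysics.KineticTheory Literature.Probability.Process OscillatorChain
open Summit.AtomisticToContinuum.FouriersLaw.Theorems.SubdiffusiveBondHeat

/-! ## The third-order envelope from three nested interval integrals -/

/-- A measurable function bounded on `[0, b]` is interval integrable on `[0, b]`. [folklore] -/
theorem prep_intervalIntegrable_of_bound {f : ℝ → ℝ} (hf : Measurable f) {b M : ℝ} (hb : 0 ≤ b)
    (hM : ∀ x, 0 ≤ x → x ≤ b → |f x| ≤ M) : IntervalIntegrable f volume 0 b := by
  refine (intervalIntegrable_iff_integrableOn_Icc_of_le hb).2 ?_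
  refine Measure.integrableOn_of_bounded (M := M) (measure_Icc_lt_top).ne hf.aestronglyMeasurable ?_
  filter_upwards [ae_restrict_mem measurableSet_Icc] with x hx
  rw [Real.norm_eq_abs]
  exact hM x hx.1 hx.2

/-- **Third-order envelope.** If `A(r) = ∫₀ʳ B`, `B(s) = ∫₀ˢ C`, `C(u) = c₀ + ∫₀ᵘ D` for non-negative arguments, with
`B, C` measurable, `D` bounded by `M` on `[0,∞)`, then `|A(r) - c₀ r²/2| ≤ M r³/6` for all `r ≥ 0`. [folklore] -/
theorem prep_taylor3 {A B C D : ℝ → ℝ} {c₀ M : ℝ} (hBm : Measurable B) (hCm : Measurable C)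
    (hA : ∀ r, 0 ≤ r → A r = ∫ s in (0 : ℝ)..r, B s) (hB : ∀ s, 0 ≤ s → B s = ∫ u in (0 : ℝ)..s, C u)
    (hC : ∀ u, 0 ≤ u → C u = c₀ + ∫ w in (0 : ℝ)..u, D w) (hD : ∀ w, 0 ≤ w → |D w| ≤ M)
    (r : ℝ) (hr : 0 ≤ r) : |A r - c₀ * r ^ 2 / 2| ≤ M * r ^ 3 / 6 := by
  have hM0 : 0 ≤ M := (abs_nonneg _).trans (hD 0 le_rfl)
  -- level 3: `|C u - c₀| ≤ M u`
  have hCb : ∀ u, 0 ≤ u → |C u - c₀| ≤ M * u := by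
    intro u hu
    rw [hC u hu, add_sub_cancel_left]
    have h := intervalIntegral.norm_integral_le_of_norm_le_const (a := 0) (b := u) (C := M) (f := D)
      (fun w hw => by
        rw [uIoc_of_le hu] at hw
        rw [Real.norm_eq_abs]; exact hD w hw.1.le)
    rw [Real.norm_eq_abs, sub_zero, abs_of_nonneg hu] at h
    linarith
  -- level 2: `|B s - c₀ s| ≤ M s²/2`
  have hBb : ∀ s, 0 ≤ s → |B s - c₀ * s| ≤ M * s ^ 2 / 2 := by
    intro s hs
    have hCi : IntervalIntegrable C volume 0 s :=
      prep_intervalIntegrable_of_bound hCm hs (M := |c₀| + M * s) fun x hx hxs => by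
        have := hCb x hx
        have h1 : |C x| ≤ |C x - c₀| + |c₀| := by
          have := abs_add_le (C x - c₀) c₀; rwa [sub_add_cancel] at this
        nlinarith
    have hup : ∫ u in (0 : ℝ)..s, C u ≤ ∫ u in (0 : ℝ)..s, (c₀ + M * u) := by
      refine intervalIntegral.integral_mono_on hs hCi
        ((by fun_prop : Continuous fun u : ℝ => c₀ + M * u).intervalIntegrable _ _) fun u hu => ?_
      have := (abs_le.1 (hCb u hu.1)).2; linarith
    have hlo : ∫ u in (0 : ℝ)..s, (c₀ - M * u) ≤ ∫ u in (0 : ℝ)..s, C u := by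
      refine intervalIntegral.integral_mono_on hs
        ((by fun_prop : Continuous fun u : ℝ => c₀ - M * u).intervalIntegrable _ _) hCi fun u hu => ?_
      have := (abs_le.1 (hCb u hu.1)).1; linarith
    have j1 : IntervalIntegrable (fun _ : ℝ => c₀) volume 0 s := intervalIntegrable_const
    have j2 : IntervalIntegrable (fun u : ℝ => M * u) volume 0 s :=
      (by fun_prop : Continuous fun u : ℝ => M * u).intervalIntegrable _ _
    have e0 : ∫ u in (0 : ℝ)..s, M * u = M * s ^ 2 / 2 := by
      rw [intervalIntegral.integral_const_mul, integral_id]; ring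
    have e1 : ∫ u in (0 : ℝ)..s, (c₀ + M * u) = c₀ * s + M * s ^ 2 / 2 := by
      rw [intervalIntegral.integral_add j1 j2, intervalIntegral.integral_const, e0]
      simp [mul_comm]
    have e2 : ∫ u in (0 : ℝ)..s, (c₀ - M * u) = c₀ * s - M * s ^ 2 / 2 := by
      rw [intervalIntegral.integral_sub j1 j2, intervalIntegral.integral_const, e0]
      simp [mul_comm]
    rw [hB s hs, abs_le]
    constructor <;> linarith
  -- level 1: `|A r - c₀ r²/2| ≤ M r³/6`
  have hBi : IntervalIntegrable B volume 0 r :=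
    prep_intervalIntegrable_of_bound hBm hr (M := |c₀| * r + M * r ^ 2 / 2) fun x hx hxr => by
      have := hBb x hx
      have h1 : |B x| ≤ |B x - c₀ * x| + |c₀ * x| := by
        have := abs_add_le (B x - c₀ * x) (c₀ * x); rwa [sub_add_cancel] at this
      rw [abs_mul, abs_of_nonneg hx] at h1
      have h2 : |c₀| * x ≤ |c₀| * r := mul_le_mul_of_nonneg_left hxr (abs_nonneg _)
      have h3 : M * x ^ 2 / 2 ≤ M * r ^ 2 / 2 := by
        have : x ^ 2 ≤ r ^ 2 := pow_le_pow_left₀ hx hxr 2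
        nlinarith
      linarith
  have hup : ∫ s in (0 : ℝ)..r, B s ≤ ∫ s in (0 : ℝ)..r, (c₀ * s + M * s ^ 2 / 2) := by
    refine intervalIntegral.integral_mono_on hr hBi
      ((by fun_prop : Continuous fun s : ℝ => c₀ * s + M * s ^ 2 / 2).intervalIntegrable _ _) fun s hs => ?_
    have := (abs_le.1 (hBb s hs.1)).2; linarith
  have hlo : ∫ s in (0 : ℝ)..r, (c₀ * s - M * s ^ 2 / 2) ≤ ∫ s in (0 : ℝ)..r, B s := by
    refine intervalIntegral.integral_mono_on hr
      ((by fun_prop : Continuous fun s : ℝ => c₀ * s - M * s ^ 2 / 2).intervalIntegrable _ _) hBi fun s hs => ?_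
    have := (abs_le.1 (hBb s hs.1)).1; linarith
  have i1 : IntervalIntegrable (fun s : ℝ => c₀ * s) volume 0 r := (continuous_const.mul continuous_id).intervalIntegrable _ _
  have i2 : IntervalIntegrable (fun s : ℝ => M * s ^ 2 / 2) volume 0 r := (by fun_prop : Continuous fun s : ℝ => M * s ^ 2 / 2).intervalIntegrable _ _
  have e3 : ∫ s in (0 : ℝ)..r, M * s ^ 2 / 2 = M * r ^ 3 / 6 := by
    have : (fun s : ℝ => M * s ^ 2 / 2) = fun s : ℝ => (M / 2) * s ^ 2 := by funext s; ring
    rw [this, intervalIntegral.integral_const_mul, integral_pow]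
    simp; ring
  have e4 : ∫ s in (0 : ℝ)..r, c₀ * s = c₀ * r ^ 2 / 2 := by
    rw [intervalIntegral.integral_const_mul, integral_id]; simp; ring
  have e1 : ∫ s in (0 : ℝ)..r, (c₀ * s + M * s ^ 2 / 2) = c₀ * r ^ 2 / 2 + M * r ^ 3 / 6 := by
    rw [intervalIntegral.integral_add i1 i2, e3, e4]
  have e2 : ∫ s in (0 : ℝ)..r, (c₀ * s - M * s ^ 2 / 2) = c₀ * r ^ 2 / 2 - M * r ^ 3 / 6 := by
    rw [intervalIntegral.integral_sub i1 i2, e3, e4]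
  rw [hA r hr, abs_le]
  constructor <;> linarith

/-- **Registered form of the third-order envelope** (stub `sa_taylorThree`). [folklore] -/
theorem sa_taylorThree :
    ∀ (A B C D : ℝ → ℝ) (c₀ M : ℝ), Measurable B → Measurable C →
      (∀ r, 0 ≤ r → A r = ∫ s in (0 : ℝ)..r, B s) → (∀ s, 0 ≤ s → B s = ∫ u in (0 : ℝ)..s, C u) →
      (∀ u, 0 ≤ u → C u = c₀ + ∫ w in (0 : ℝ)..u, D w) → (∀ w, 0 ≤ w → |D w| ≤ M) →
      ∀ r : ℝ, 0 ≤ r → |A r - c₀ * r ^ 2 / 2| ≤ M * r ^ 3 / 6 :=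
  fun _ _ _ _ _ _ hBm hCm hA hB hC hD r hr => prep_taylor3 hBm hCm hA hB hC hD r hr

/-! ## Fixed-`N` Gibbs tools -/

section Gibbs

variable {ω₂ lam β γ : ℝ} (hω : 0 < ω₂) (hl : 0 ≤ lam) (hβ : 0 < β) (hγ : 0 < γ) {T : ℝ} (hT : 0 < T)
include hω hl hβ hγ hT

omit hγ in
/-- **`N`-uniform even moments of positions and momenta** under the Gibbs measure, with integrability: for every
`m` there is `C` with `∫ q_i^{2m} dμ_T ≤ C`, `∫ p_i^{2m} dμ_T ≤ C`, both integrands integrable, for ALL `n` and all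
sites `i` (`stub_gibbsMoments` fed with the proved Brascamp–Lieb Poincaré inequality `stub_gibbsPoincare`; integrability
from `q_i^{2m}, p_i^{2m} = O((1+H)^m)`). [folklore] -/
theorem prep_uniform_even_moments (m : ℕ) :
    ∃ C : ℝ, ∀ (n : ℕ) (i : Fin n),
      Integrable (fun x : PhaseSpace n => (x.1 i) ^ (2 * m)) ((pinnedChain ω₂ lam β γ).gibbsMeasure n T) ∧
      Integrable (fun x : PhaseSpace n => (x.2 i) ^ (2 * m)) ((pinnedChain ω₂ lam β γ).gibbsMeasure n T) ∧
      ∫ x, (x.1 i) ^ (2 * m) ∂((pinnedChain ω₂ lam β γ).gibbsMeasure n T) ≤ C ∧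
      ∫ x, (x.2 i) ^ (2 * m) ∂((pinnedChain ω₂ lam β γ).gibbsMeasure n T) ≤ C := by
  obtain ⟨C, hC⟩ := SubBallisticWindow.GibbsMoments.stub_gibbsMoments ω₂ lam β γ hω hl hβ.le T hT
    (SubBallisticWindow.GibbsPoincare.stub_gibbsPoincare ω₂ lam β γ hω hl hβ.le T hT) m
  refine ⟨C, fun n i => ?_⟩
  set P := pinnedChain ω₂ lam β γ with hP
  have hZ : 0 < ∫ x, P.gibbsDensity n T x := integral_exp_pos (pinnedChain_integrable_gibbsDensity hω hl hβ.le γ n hT)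
  -- pointwise polynomial bounds by powers of `1 + H`
  have hH0 : ∀ x, 0 ≤ P.hamiltonian n x := fun x => pinnedChain_hamiltonian_nonneg hω.le hl hβ.le γ n x
  have hq2 : ∀ x : PhaseSpace n, x.1 i ^ 2 ≤ (2 / ω₂) * (1 + P.hamiltonian n x) := by
    intro x
    have h := pinnedChain_harmonic_le_hamiltonian (ω₂ := ω₂) hl hβ.le γ n x
    have h1 : ω₂ * x.1 i ^ 2 / 2 ≤ ∑ j, ω₂ * x.1 j ^ 2 / 2 :=
      Finset.single_le_sum (f := fun j => ω₂ * x.1 j ^ 2 / 2) (fun j _ => by positivity) (Finset.mem_univ _)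
    have h2 : 0 ≤ ∑ j, x.2 j ^ 2 / 2 := Finset.sum_nonneg fun j _ => by positivity
    rw [div_mul_eq_mul_div, le_div_iff₀ hω]
    nlinarith [hH0 x]
  have hp2 : ∀ x : PhaseSpace n, x.2 i ^ 2 ≤ 2 * (1 + P.hamiltonian n x) := by
    intro x
    have h := pinnedChain_harmonic_le_hamiltonian (ω₂ := ω₂) hl hβ.le γ n x
    have h1 : x.2 i ^ 2 / 2 ≤ ∑ j, x.2 j ^ 2 / 2 :=
      Finset.single_le_sum (f := fun j => x.2 j ^ 2 / 2) (fun j _ => by positivity) (Finset.mem_univ _)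
    have h2 : 0 ≤ ∑ j, ω₂ * x.1 j ^ 2 / 2 := Finset.sum_nonneg fun j _ => by positivity
    nlinarith [hH0 x]
  have hqi : Integrable (fun x : PhaseSpace n => (x.1 i) ^ (2 * m)) (P.gibbsMeasure n T) := by
    refine statics_integrable_of_le_pow hω hl hβ.le γ n hT m (by fun_prop) (C := (2 / ω₂) ^ m) fun x => ?_
    rw [pow_mul, abs_of_nonneg (pow_nonneg (sq_nonneg _) _), ← mul_pow]
    exact pow_le_pow_left₀ (sq_nonneg _) (hq2 x) m
  have hpi : Integrable (fun x : PhaseSpace n => (x.2 i) ^ (2 * m)) (P.gibbsMeasure n T) := by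
    refine statics_integrable_of_le_pow hω hl hβ.le γ n hT m (by fun_prop) (C := 2 ^ m) fun x => ?_
    rw [pow_mul, abs_of_nonneg (pow_nonneg (sq_nonneg _) _), ← mul_pow]
    exact pow_le_pow_left₀ (sq_nonneg _) (hp2 x) m
  obtain ⟨h1, h2⟩ := hC n i
  rw [SubBallisticWindow.GibbsMoments.integral_gibbs γ n rfl] at h1 h2
  have h1' : ∫ x, (x.1 i) ^ (2 * m) * P.gibbsDensity n T x ≤ C * ∫ x, P.gibbsDensity n T x := h1
  have h2' : ∫ x, (x.2 i) ^ (2 * m) * P.gibbsDensity n T x ≤ C * ∫ x, P.gibbsDensity n T x := h2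
  refine ⟨hqi, hpi, ?_, ?_⟩
  · rw [P.integral_gibbsMeasure, inv_mul_le_iff₀ hZ]; linarith
  · rw [P.integral_gibbsMeasure, inv_mul_le_iff₀ hZ]; linarith

/-- **Pairings against the kernels are bounded by the `L²` norms**: for continuous `a`, `g` dominated by `e^{ϑH}`
(`0 < ϑ`, `2ϑ < 1/T`), `|∫ a · (K_u g) dμ_T| ≤ (∫ a² dμ_T + ∫ g² dμ_T)/2` for every `u` (AM–GM and the
`L²(μ_T)`-contraction `∫ (K_u g)² ≤ ∫ g²`). [folklore] -/
theorem prep_abs_corr_le {n : ℕ} (hn : 0 < n) {ϑ : ℝ} (hϑ0 : 0 < ϑ) (h2ϑ : 2 * ϑ < 1 / T)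
    {a g : PhaseSpace n → ℝ} (ha : Continuous a) (hg : Continuous g) {Ma Mg : ℝ}
    (haM : ∀ y, |a y| ≤ Ma * Real.exp (ϑ * (pinnedChain ω₂ lam β γ).hamiltonian n y))
    (hgM : ∀ y, |g y| ≤ Mg * Real.exp (ϑ * (pinnedChain ω₂ lam β γ).hamiltonian n y)) (u : ℝ≥0) :
    |∫ z, a z * (∫ y, g y ∂((pinnedChain ω₂ lam β γ).transitionKernel n T T u z))
        ∂((pinnedChain ω₂ lam β γ).gibbsMeasure n T)| ≤
      ((∫ z, a z ^ 2 ∂((pinnedChain ω₂ lam β γ).gibbsMeasure n T)) +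
        ∫ z, g z ^ 2 ∂((pinnedChain ω₂ lam β γ).gibbsMeasure n T)) / 2 := by
  obtain ⟨ha2, -, -⟩ := pinnedChain_integral_sq_act_le hω hl hβ hγ hn hT hϑ0 h2ϑ ha haM u
  obtain ⟨-, hKg2, hle⟩ := pinnedChain_integral_sq_act_le hω hl hβ hγ hn hT hϑ0 h2ϑ hg hgM u
  have h := abs_integral_mul_le_weighted ha2 hKg2 one_pos
  rw [one_mul, inv_one, one_mul] at h
  linarith

end Gibbs

end Summit.AtomisticToContinuum.FouriersLaw.Theorems.CoherentDephasing.StrictAbsorption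

end
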